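import Mathlib
import Summits.NavierStokesRegularity.NavierStokesRegularity.Theorems.EulerZoomLiouvillePowerGaugeEulerLiouvilleCondenserCircleMeanDerivative

/-!
# THE POLAR FRAME ON A SLICE — tools for plate t50-Ib «ConvectivePolarIdentity» of nsreg-p2 ROUND-47
«WHO HOLDS THE RIDGE» (`r47/Sketch47.lean` sha16 c5b0bf755040b563)

Width piece for crux `EulerZoomLiouville.PowerGaugeEulerLiouville` (stmt-NavierStokesRegularity-19832), by name under
LEAD 19832 (ns-typeII-p2 g14) and planner nsreg-p2 g37; seat ns-ezl-w2 g5,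
`--supports stmt-NavierStokesRegularity-19832 --as helper`.

Plane kinematics in the polar frame `r̂ = e^{iθ} = circleMap 0 1 θ`, `θ̂ = i e^{iθ}` at `z = ρe^{iθ} = circleMap 0 ρ θ`,
for a planar field `v : ℂ → ℂ` (real inner product `⟪·,·⟫` of `ℂ`, `v_r = ⟪v, r̂⟫`, `v_θ = ⟪v, θ̂⟫`):

* algebra of a real-linear `L : ℂ →L[ℝ] ℂ` in the frame: `L w = w.re • L 1 + w.im • L i`;
  `⟪L w, u⟫ = ⟪w,u⟫⟪L u,u⟫ + ⟪w,ui⟫⟪L(ui),u⟫` (`inner_clm_apply_polar`) and the trace identity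
  `⟪L u,u⟫ + ⟪L(ui),ui⟫ = (L 1).re + (L i).im` (`inner_clm_polar_trace`) for a unit vector `u`;
* derivatives: `∂_θ v(ρe^{iθ}) = Dv[ρ i e^{iθ}]`, `∂_θ v_r = ρ⟪Dv[θ̂], r̂⟫ + v_θ`, `∂_θ v_θ = ρ⟪Dv[θ̂], θ̂⟫ − v_r`,
  `∂_ρ v_r = ⟪Dv[r̂], r̂⟫` (`hasDerivAt_inner_radial_angle`, `hasDerivAt_inner_tangential_angle`,
  `hasDerivAt_inner_radial_radius`);
* `‖z‖⁻¹ z = r̂` on the circle of radius `ρ > 0` (`inv_norm_smul_circleMap`); joint continuity of the polar integrands.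

HONEST FRAMING: plane calculus; proves nothing about the crux E (19832 OPEN), any door Target, THEOREM K⁗, or
Navier–Stokes regularity; no summit statement is touched. [folklore]
-/

noncomputable section

open Set Filter Topology Metric Function MeasureTheory Complex
open scoped Real RealInnerProductSpace

set_option linter.dupNamespace false

namespace Summit.NavierStokesRegularity.NavierStokesRegularity.Theorems.PowerGaugeEulerLiouville.Condenser

/-! ## §1 Algebra of a real-linear map of the plane in a unit frame -/

/-- A real-linear map of `ℂ` in the basis `1, i`: `L w = w.re • L 1 + w.im • L i`. [folklore] -/
theorem clm_apply_eq_re_smul_add_im_smul (L : ℂ →L[ℝ] ℂ) (w : ℂ) : L w = w.re • L 1 + w.im • L I := by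
  conv_lhs => rw [← re_add_im w]
  rw [map_add]
  have h1 : ((w.re : ℝ) : ℂ) = w.re • (1 : ℂ) := by rw [real_smul, mul_one]
  have h2 : ((w.im : ℝ) : ℂ) * I = w.im • I := by rw [real_smul]
  rw [h1, h2, map_smul, map_smul]

/-- The real inner product of `ℂ` in coordinates: `⟪w, z⟫ = w.re z.re + w.im z.im`. [folklore] -/
theorem real_inner_complex_eq (w z : ℂ) : ⟪w, z⟫ = w.re * z.re + w.im * z.im := by
  rw [Complex.inner, mul_re, conj_re, conj_im]; ring

/-- **Radial component of `L w` in the polar frame**: for a real-linear `L` and a unit vector `u`,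
`⟪L w, u⟫ = ⟪w, u⟫⟪L u, u⟫ + ⟪w, ui⟫⟪L(ui), u⟫` (expand `w = ⟪w,u⟫u + ⟪w,ui⟫ui`). [folklore] -/
theorem inner_clm_apply_polar (L : ℂ →L[ℝ] ℂ) (w : ℂ) {u : ℂ} (hu : ‖u‖ = 1) :
    ⟪L w, u⟫ = ⟪w, u⟫ * ⟪L u, u⟫ + ⟪w, u * I⟫ * ⟪L (u * I), u⟫ := by
  have hu2 : u.re ^ 2 + u.im ^ 2 = 1 := by
    have h : ‖u‖ ^ 2 = 1 := by rw [hu, one_pow]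
    rw [Complex.sq_norm, normSq_apply] at h
    nlinarith [h]
  rw [clm_apply_eq_re_smul_add_im_smul L w, clm_apply_eq_re_smul_add_im_smul L u,
    clm_apply_eq_re_smul_add_im_smul L (u * I)]
  simp only [real_inner_complex_eq, add_re, add_im, smul_re, smul_im, mul_re, mul_im, I_re, I_im,
    smul_eq_mul, mul_zero, mul_one, add_zero]
  linear_combination
    (-((w.re * (L 1).re + w.im * (L I).re) * u.re + (w.re * (L 1).im + w.im * (L I).im) * u.im)) * hu2

/-- **Trace in the polar frame**: for a real-linear `L` and a unit vector `u`,
`⟪L u, u⟫ + ⟪L(ui), ui⟫ = (L 1).re + (L i).im` (the divergence does not depend on the orthonormal frame). [folklore] -/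
theorem inner_clm_polar_trace (L : ℂ →L[ℝ] ℂ) {u : ℂ} (hu : ‖u‖ = 1) :
    ⟪L u, u⟫ + ⟪L (u * I), u * I⟫ = (L 1).re + (L I).im := by
  have hu2 : u.re ^ 2 + u.im ^ 2 = 1 := by
    have h : ‖u‖ ^ 2 = 1 := by rw [hu, one_pow]
    rw [Complex.sq_norm, normSq_apply] at h
    nlinarith [h]
  rw [clm_apply_eq_re_smul_add_im_smul L u, clm_apply_eq_re_smul_add_im_smul L (u * I)]
  simp only [real_inner_complex_eq, add_re, add_im, smul_re, smul_im, mul_re, mul_im, I_re, I_im,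
    smul_eq_mul, mul_zero, mul_one, add_zero]
  linear_combination ((L 1).re + (L I).im) * hu2

/-- The polar decomposition of the convective term: `⟪L (v), u⟫ = v_r⟪L u,u⟫ + v_θ⟪L(ui),u⟫` combined with the
trace identity `⟪L(ui),ui⟫ = (L 1).re + (L i).im − ⟪L u,u⟫` (both restated for convenience). [folklore] -/
theorem inner_clm_tangential_tangential (L : ℂ →L[ℝ] ℂ) {u : ℂ} (hu : ‖u‖ = 1) :
    ⟪L (u * I), u * I⟫ = (L 1).re + (L I).im - ⟪L u, u⟫ := by
  have h := inner_clm_polar_trace L hu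
  linarith

/-! ## §2 The polar frame along circles -/

/-- `circleMap 0 ρ θ = ρ • circleMap 0 1 θ`. [folklore] -/
theorem circleMap_eq_smul_circleMap_one (ρ θ : ℝ) : circleMap 0 ρ θ = ρ • circleMap 0 1 θ := by
  rw [circleMap_zero, circleMap_zero, real_smul]; push_cast; ring

/-- On the circle of radius `ρ > 0`: `‖z‖⁻¹ z = e^{iθ}` for `z = ρe^{iθ}`. [folklore] -/
theorem inv_norm_smul_circleMap {ρ : ℝ} (hρ : 0 < ρ) (θ : ℝ) :
    (‖circleMap 0 ρ θ‖⁻¹ : ℝ) • circleMap 0 ρ θ = circleMap 0 1 θ := by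
  rw [norm_circleMap_zero, abs_of_pos hρ, circleMap_eq_smul_circleMap_one ρ θ, smul_smul,
    inv_mul_cancel₀ hρ.ne', one_smul]

/-- `d/dθ e^{iθ} = i e^{iθ}`, i.e. `∂_θ r̂ = θ̂`. [folklore] -/
theorem hasDerivAt_circleMap_one_angle (θ : ℝ) :
    HasDerivAt (fun θ : ℝ => circleMap 0 1 θ) (circleMap 0 1 θ * I) θ :=
  hasDerivAt_circleMap 0 1 θ

/-- `d/dθ (i e^{iθ}) = −e^{iθ}`, i.e. `∂_θ θ̂ = −r̂`. [folklore] -/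
theorem hasDerivAt_circleMap_one_mul_I_angle (θ : ℝ) :
    HasDerivAt (fun θ : ℝ => circleMap 0 1 θ * I) (-circleMap 0 1 θ) θ := by
  refine ((hasDerivAt_circleMap 0 1 θ).mul_const I).congr_deriv ?_
  rw [mul_assoc, I_mul_I, mul_neg_one]

/-- **Angular derivative of `v` along a circle**: `∂_θ v(ρe^{iθ}) = ρ • Dv(ρe^{iθ})[i e^{iθ}]`. [folklore] -/
theorem hasDerivAt_comp_circleMap_angle {v : ℂ → ℂ} (hv : Differentiable ℝ v) (ρ θ : ℝ) :
    HasDerivAt (fun θ : ℝ => v (circleMap 0 ρ θ))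
      (ρ • fderiv ℝ v (circleMap 0 ρ θ) (circleMap 0 1 θ * I)) θ := by
  have h := (hv (circleMap 0 ρ θ)).hasFDerivAt.comp_hasDerivAt θ (hasDerivAt_circleMap 0 ρ θ)
  refine h.congr_deriv ?_
  rw [← map_smul]
  congr 1
  rw [circleMap_eq_smul_circleMap_one ρ θ, smul_mul_assoc]

/-- **Radial derivative of `v` along a ray**: `∂_ρ v(ρe^{iθ}) = Dv(ρe^{iθ})[e^{iθ}]`. [folklore] -/
theorem hasDerivAt_comp_circleMap_radius' {v : ℂ → ℂ} (hv : Differentiable ℝ v) (θ ρ : ℝ) :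
    HasDerivAt (fun ρ : ℝ => v (circleMap 0 ρ θ)) (fderiv ℝ v (circleMap 0 ρ θ) (circleMap 0 1 θ)) ρ :=
  (hv _).hasFDerivAt.comp_hasDerivAt ρ (hasDerivAt_circleMap_radius θ ρ)

/-- **`∂_θ v_r = ρ⟪Dv[θ̂], r̂⟫ + v_θ`.** [folklore] -/
theorem hasDerivAt_inner_radial_angle {v : ℂ → ℂ} (hv : Differentiable ℝ v) (ρ θ : ℝ) :
    HasDerivAt (fun θ : ℝ => ⟪v (circleMap 0 ρ θ), circleMap 0 1 θ⟫)
      (ρ * ⟪fderiv ℝ v (circleMap 0 ρ θ) (circleMap 0 1 θ * I), circleMap 0 1 θ⟫ +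
        ⟪v (circleMap 0 ρ θ), circleMap 0 1 θ * I⟫) θ := by
  have h := (hasDerivAt_comp_circleMap_angle hv ρ θ).inner ℝ (hasDerivAt_circleMap_one_angle θ)
  refine h.congr_deriv ?_
  rw [real_inner_smul_left]; ring

/-- **`∂_θ v_θ = ρ⟪Dv[θ̂], θ̂⟫ − v_r`.** [folklore] -/
theorem hasDerivAt_inner_tangential_angle {v : ℂ → ℂ} (hv : Differentiable ℝ v) (ρ θ : ℝ) :
    HasDerivAt (fun θ : ℝ => ⟪v (circleMap 0 ρ θ), circleMap 0 1 θ * I⟫)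
      (ρ * ⟪fderiv ℝ v (circleMap 0 ρ θ) (circleMap 0 1 θ * I), circleMap 0 1 θ * I⟫ -
        ⟪v (circleMap 0 ρ θ), circleMap 0 1 θ⟫) θ := by
  have h := (hasDerivAt_comp_circleMap_angle hv ρ θ).inner ℝ (hasDerivAt_circleMap_one_mul_I_angle θ)
  refine h.congr_deriv ?_
  rw [real_inner_smul_left, inner_neg_right]; ring

/-- **`∂_ρ v_r = ⟪Dv[r̂], r̂⟫`.** [folklore] -/
theorem hasDerivAt_inner_radial_radius {v : ℂ → ℂ} (hv : Differentiable ℝ v) (θ ρ : ℝ) :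
    HasDerivAt (fun ρ : ℝ => ⟪v (circleMap 0 ρ θ), circleMap 0 1 θ⟫)
      ⟪fderiv ℝ v (circleMap 0 ρ θ) (circleMap 0 1 θ), circleMap 0 1 θ⟫ ρ := by
  have h := (hasDerivAt_comp_circleMap_radius' hv θ ρ).inner ℝ (hasDerivAt_const ρ (circleMap 0 1 θ))
  refine h.congr_deriv ?_
  rw [inner_zero_right, zero_add]

/-- **`∂_ρ (v_r²) = 2 v_r ⟪Dv[r̂], r̂⟫`.** [folklore] -/
theorem hasDerivAt_inner_radial_sq_radius {v : ℂ → ℂ} (hv : Differentiable ℝ v) (θ ρ : ℝ) :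
    HasDerivAt (fun ρ : ℝ => ⟪v (circleMap 0 ρ θ), circleMap 0 1 θ⟫ ^ 2)
      (2 * ⟪v (circleMap 0 ρ θ), circleMap 0 1 θ⟫ *
        ⟪fderiv ℝ v (circleMap 0 ρ θ) (circleMap 0 1 θ), circleMap 0 1 θ⟫) ρ := by
  have h := (hasDerivAt_inner_radial_radius hv θ ρ).pow 2
  refine h.congr_deriv ?_
  simp only [Nat.cast_ofNat]
  ring

/-! ## §3 The convective term in the polar frame, pointwise -/

/-- **The radial component of the convective term**, pointwise on the circle of radius `ρ`:
`⟪Dv[v], r̂⟫ = v_r⟪Dv[r̂], r̂⟫ + v_θ⟪Dv[θ̂], r̂⟫`. [folklore] -/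
theorem inner_fderiv_self_radial_eq {v : ℂ → ℂ} (ρ θ : ℝ) :
    ⟪fderiv ℝ v (circleMap 0 ρ θ) (v (circleMap 0 ρ θ)), circleMap 0 1 θ⟫ =
      ⟪v (circleMap 0 ρ θ), circleMap 0 1 θ⟫ *
          ⟪fderiv ℝ v (circleMap 0 ρ θ) (circleMap 0 1 θ), circleMap 0 1 θ⟫ +
        ⟪v (circleMap 0 ρ θ), circleMap 0 1 θ * I⟫ *
          ⟪fderiv ℝ v (circleMap 0 ρ θ) (circleMap 0 1 θ * I), circleMap 0 1 θ⟫ :=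
  inner_clm_apply_polar _ _ (by rw [norm_circleMap_zero, abs_one])

/-- **Polar form of the divergence**, pointwise: if `(Dv 1).re + (Dv i).im = −b` then on the circle of radius `ρ`
`⟪Dv[θ̂], θ̂⟫ = −b − ⟪Dv[r̂], r̂⟫`. [folklore] -/
theorem inner_fderiv_tangential_eq_of_div {v : ℂ → ℂ} {b : ℂ → ℝ}
    (hdiv : ∀ z : ℂ, (fderiv ℝ v z 1).re + (fderiv ℝ v z I).im = -b z) (ρ θ : ℝ) :
    ⟪fderiv ℝ v (circleMap 0 ρ θ) (circleMap 0 1 θ * I), circleMap 0 1 θ * I⟫ =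
      -b (circleMap 0 ρ θ) - ⟪fderiv ℝ v (circleMap 0 ρ θ) (circleMap 0 1 θ), circleMap 0 1 θ⟫ := by
  rw [inner_clm_tangential_tangential _ (by rw [norm_circleMap_zero, abs_one]), hdiv]

/-! ## §4 Joint continuity of the polar integrands -/

/-- For `v ∈ C¹` and continuous frame fields `e₁ e₂ : ℝ → ℂ` of the angle, the polar integrand
`(ρ,θ) ↦ ⟪Dv(ρe^{iθ})[e₁ θ], e₂ θ⟫` is jointly continuous. [folklore] -/
theorem continuous_inner_fderiv_polar {v : ℂ → ℂ} (hv : ContDiff ℝ 1 v) {e₁ e₂ : ℝ → ℂ}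
    (he₁ : Continuous e₁) (he₂ : Continuous e₂) :
    Continuous fun p : ℝ × ℝ => ⟪fderiv ℝ v (circleMap 0 p.1 p.2) (e₁ p.2), e₂ p.2⟫ := by
  have hcm : Continuous fun p : ℝ × ℝ => circleMap 0 p.1 p.2 := by unfold circleMap; fun_prop
  exact (((hv.continuous_fderiv one_ne_zero).comp hcm).clm_apply (he₁.comp continuous_snd)).inner
    (he₂.comp continuous_snd)

/-- For continuous `v` and a continuous frame field `e`, `(ρ,θ) ↦ ⟪v(ρe^{iθ}), e θ⟫` is jointly continuous.
[folklore] -/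
theorem continuous_inner_comp_polar {v : ℂ → ℂ} (hv : Continuous v) {e : ℝ → ℂ} (he : Continuous e) :
    Continuous fun p : ℝ × ℝ => ⟪v (circleMap 0 p.1 p.2), e p.2⟫ := by
  have hcm : Continuous fun p : ℝ × ℝ => circleMap 0 p.1 p.2 := by unfold circleMap; fun_prop
  exact (hv.comp hcm).inner (he.comp continuous_snd)

/-- The frame fields `θ ↦ e^{iθ}` and `θ ↦ ie^{iθ}` are continuous. [folklore] -/
theorem continuous_circleMap_one_frame :
    Continuous (fun θ : ℝ => circleMap 0 1 θ) ∧ Continuous (fun θ : ℝ => circleMap 0 1 θ * I) :=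
  ⟨continuous_circleMap 0 1, (continuous_circleMap 0 1).mul continuous_const⟩

end Summit.NavierStokesRegularity.NavierStokesRegularity.Theorems.PowerGaugeEulerLiouville.Condenser

end
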